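import Summits.CriticalPhenomena.CardyFormulaZ2.Theorems.CardyAnchoredRigiditySubseqCardyReduction
import Summits.CriticalPhenomena.CardyFormulaZ2.Theorems.CardyAnchoredRigiditySubseqCardyJointLimit
import Summits.CriticalPhenomena.CardyFormulaZ2.Theorems.CardyAnchoredRigiditySubseqCardyJointLimitCluster

/-!
# Crux `SubseqCardy` (stmt-CriticalPhenomena-5768): the strategist's split
# `SubseqCardy ⟸ ConformalSublimit ∧ SubseqRigidity`, and the kernel position of `ConformalSublimit`

Route `CardyAnchoredRigidity` (decl shared verbatim with `CardyLocalRigidity`), sub-problem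
`CardyFormulaZ2`. The registered line `birth` closes the crux modulo the two existing items
stmt-8266 `CardyMirrorMonotone.SubseqConformalInvariance` ("X_M": EVERY joint sequential limit of the
bond-`ℤ²` crossing probabilities factors through the conformal modulus — in cluster-set language
`Λ' ⊆ CI`) and stmt-8271 `CardyMirrorMonotone.SubseqRigidity` (a modulus kernel of a joint sequential
limit is Cardy's `F` on `(0,1)`), `subseqCardy_of_items` (Reduction file).

For THIS route X_M is more than the frame consumes: `SubseqCardy` only asks that the Cardy shadow be
ONE cluster point, and the route's own cruxes `CardyShadowIsolated` (5767) + `ClusterSetConnected`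
(5769, proved) do the uniqueness work; with X_M instead, `8266 ∧ 8271` already force `Λ' = {Cardy}`
and the route's lever is idle. The faithful first child is the EXISTENTIAL statement

  `ConformalSublimit`: there are a mesh sequence `u → 0⁺` and a kernel `G : ℝ → ℝ` with
  `bondDomainCrossingProb R (u n) → G (crossRatio x)` for every conformal rectangle `R` and every
  uniformizing datum `(φ, x)` of `R` — SOME joint sequential limit is conformally invariant, value
  free (`Λ' ∩ CI ≠ ∅`),

written INLINE below (it is not yet a declaration of any route file; the split files it as the child
`ConformalSublimit` of `SubseqCardy`). This file proves, sorry-free and over landed theorems only: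

* `subseqCardy_of_conformalSublimit_of_subseqRigidity` — THE GLUE of the split:
  `ConformalSublimit → SubseqRigidity → SubseqCardy` (rigidity identifies the kernel with `F` on
  `(0,1)`, where all moduli of uniformizing data lie);
* `conformalSublimit_of_subseqCardy` — the child is a CONSEQUENCE of the crux (`G := F`), hence of
  `CardyFormulaZ2`; so, given `SubseqRigidity`, the crux is EQUIVALENT to the child
  (`subseqCardy_iff_conformalSublimit`);
* `conformalSublimit_of_subseqConformalInvariance` — the child is implied by X_M (run X_M along
  `1/(n+1)`): it is the weakest statement in the chain `CardyFormulaZ2 → X_M → ConformalSublimit`;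
* `conformalSublimit_iff_exists_conformal_clusterPt` — the child in the route's cluster-set language:
  SOME cluster point of the crossing-function path factors through the modulus (`Λ' ∩ CI ≠ ∅`),
  against `subseqConformalInvariance_iff_forall_clusterPt_conformal`: X_M says EVERY cluster point
  does (`Λ' ⊆ CI`). The gap between the two is exactly the freedom to SELECT the subsequence
  (recurrent points / invariant measures of the dilation flow on `Λ'`, extremal cluster points),
  which no statement of the `∀`-form can use.

References: O. Schramm, Proc. ICM 2006, Problem 2.11; S. Smirnov, C. R. Acad. Sci. 333 (2001);
F. Camia, C. M. Newman, Probab. Theory Related Fields 139 (2007) §5–7; O. Schramm, S. Smirnov,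
Ann. Probab. 39 (2011) §1.3, §5.
-/

namespace Summit.CriticalPhenomena.CardyFormulaZ2.Cruxes.SubseqCardy.Split

open Filter Topology Set
open Literature.Probability.RandomPlanarGeometry
open Literature.Probability.Percolation hiding cardyFunction
open Summit.CriticalPhenomena.CardyFormulaZ2.Theses
open Summit.CriticalPhenomena.CardyFormulaZ2.Cruxes.SubseqCardy.Birth

/-! ### The glue of the split -/

/-- **`SubseqCardy` from a conformally invariant sublimit and sequential rigidity (the glue of the
strategist's split).** If along SOME mesh sequence `u → 0⁺` the crossing probabilities of every
conformal rectangle converge to `G (crossRatio x)` at every uniformizing datum, and modulus kernels of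
joint sequential limits are rigid (`CardyMirrorMonotone.SubseqRigidity`, stmt-8271), then Cardy's
formula holds along `u`: rigidity gives `G = F` on `(0,1)` and every modulus of a uniformizing datum
lies in `(0,1)` (`ConformalRectangle.crossRatio_mem_Ioo_of_isUniformizing`). [folklore] -/
theorem subseqCardy_of_conformalSublimit_of_subseqRigidity : (∃ u : ℕ → ℝ, Filter.Tendsto u Filter.atTop (nhdsWithin (0 : ℝ) (Set.Ioi 0)) ∧ ∃ G : ℝ → ℝ, ∀ (R : Literature.Probability.RandomPlanarGeometry.ConformalRectangle) (ψ : Literature.Probability.RandomPlanarGeometry.ConformalEquiv UpperHalfPlane.upperHalfPlaneSet R.carrier) (x : Fin 4 → ℝ), R.IsUniformizing ψ x → Filter.Tendsto (fun n => Literature.Probability.Percolation.bondDomainCrossingProb R (u n)) Filter.atTop (nhds (G (Literature.Probability.RandomPlanarGeometry.crossRatio x)))) → Summit.CriticalPhenomena.CardyFormulaZ2.Theses.CardyMirrorMonotone.SubseqRigidity → Summit.CriticalPhenomena.CardyFormulaZ2.Theses.CardyAnchoredRigidity.SubseqCardy := by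
  rintro ⟨u, hu, G, hG⟩ hRig
  have hEq : EqOn G Literature.Probability.RandomPlanarGeometry.cardyFunction (Ioo 0 1) :=
    hRig u hu G hG
  refine ⟨u, hu, fun R ψ x hx => ?_⟩
  rw [← hEq (ConformalRectangle.crossRatio_mem_Ioo_of_isUniformizing hx)]
  exact hG R ψ x hx

/-! ### Kernel position of the child -/

/-- **The child is a consequence of the crux.** `SubseqCardy` is the child with the kernel
`G := cardyFunction`. [folklore] -/
theorem conformalSublimit_of_subseqCardy : Summit.CriticalPhenomena.CardyFormulaZ2.Theses.CardyAnchoredRigidity.SubseqCardy → ∃ u : ℕ → ℝ, Filter.Tendsto u Filter.atTop (nhdsWithin (0 : ℝ) (Set.Ioi 0)) ∧ ∃ G : ℝ → ℝ, ∀ (R : Literature.Probability.RandomPlanarGeometry.ConformalRectangle) (ψ : Literature.Probability.RandomPlanarGeometry.ConformalEquiv UpperHalfPlane.upperHalfPlaneSet R.carrier) (x : Fin 4 → ℝ), R.IsUniformizing ψ x → Filter.Tendsto (fun n => Literature.Probability.Percolation.bondDomainCrossingProb R (u n)) Filter.atTop (nhds (G (Literature.Probability.RandomPlanarGeometry.crossRatio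 x))) := by
  rintro ⟨u, hu, h⟩
  exact ⟨u, hu, Literature.Probability.RandomPlanarGeometry.cardyFunction, h⟩

/-- **Given sequential rigidity, the crux IS the child.** [folklore] -/
theorem subseqCardy_iff_conformalSublimit : Summit.CriticalPhenomena.CardyFormulaZ2.Theses.CardyMirrorMonotone.SubseqRigidity → (Summit.CriticalPhenomena.CardyFormulaZ2.Theses.CardyAnchoredRigidity.SubseqCardy ↔ ∃ u : ℕ → ℝ, Filter.Tendsto u Filter.atTop (nhdsWithin (0 : ℝ) (Set.Ioi 0)) ∧ ∃ G : ℝ → ℝ, ∀ (R : Literature.Probability.RandomPlanarGeometry.ConformalRectangle) (ψ : Literature.Probability.RandomPlanarGeometry.ConformalEquiv UpperHalfPlane.upperHalfPlaneSet R.carrier) (x : Fin 4 → ℝ), R.IsUniformizing ψ x → Filter.Tendsto (fun n => Literature.Probability.Percolation.bondDomainCrossingProb R (u n)) Filter.atTop (nhds (G (Literature.Probability.RandomPlanarGeometry.crossRatio x)))) :=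
  fun hRig => ⟨conformalSublimit_of_subseqCardy, fun h => subseqCardy_of_conformalSublimit_of_subseqRigidity h hRig⟩

/-- **The child is implied by X_M (stmt-8266).** Run `SubseqConformalInvariance` along the meshes
`1/(n+1)`; the extracted subsequence is the witness. So the child is the weakest statement of the
chain `CardyFormulaZ2 → X_M → ConformalSublimit`. [folklore] -/
theorem conformalSublimit_of_subseqConformalInvariance : Summit.CriticalPhenomena.CardyFormulaZ2.Theses.CardyMirrorMonotone.SubseqConformalInvariance → ∃ u : ℕ → ℝ, Filter.Tendsto u Filter.atTop (nhdsWithin (0 : ℝ) (Set.Ioi 0)) ∧ ∃ G : ℝ → ℝ, ∀ (R : Literature.Probability.RandomPlanarGeometry.ConformalRectangle) (ψ : Literature.Probability.RandomPlanarGeometry.ConformalEquiv UpperHalfPlane.upperHalfPlaneSet R.carrier) (x : Fin 4 → ℝ), R.IsUniformizing ψ x → Filter.Tendsto (fun n => Literature.Probability.Percolation.bondDomainCrossingProb R (u n)) Filter.atTop (nhds (G (Literature.Probability.RandomPlanarGeometry.crossRatio x))) := by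
  intro hXM
  have hu₀ : Tendsto (fun n : ℕ => 1 / ((n : ℝ) + 1)) atTop (𝓝[>] (0 : ℝ)) :=
    tendsto_one_div_strictMono_add_one_nhdsWithin_Ioi strictMono_id
  obtain ⟨φ, hφ, G, hG⟩ := hXM _ hu₀
  exact ⟨fun n : ℕ => 1 / (((φ n : ℕ) : ℝ) + 1), tendsto_one_div_strictMono_add_one_nhdsWithin_Ioi hφ,
    G, hG⟩

/-- **`CardyFormulaZ2` implies the child** (through the crux: a full limit is a limit along
`1/(n+1)`). [folklore] -/
theorem conformalSublimit_of_cardyFormulaZ2 : Literature.Probability.Percolation.CardyFormulaZ2 → ∃ u : ℕ → ℝ, Filter.Tendsto u Filter.atTop (nhdsWithin (0 : ℝ) (Set.Ioi 0)) ∧ ∃ G : ℝ → ℝ, ∀ (R : Literature.Probability.RandomPlanarGeometry.ConformalRectangle) (ψ : Literature.Probability.RandomPlanarGeometry.ConformalEquiv UpperHalfPlane.upperHalfPlaneSet R.carrier) (x : Fin 4 → ℝ), R.IsUniformizing ψ x → Filter.Tendsto (fun n => Literature.Probability.Percolation.bondDomainCrossingProb R (u n)) Filter.atTop (nhds (G (Literature.Probability.RandomPlanarGeometry.crossRatio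 x))) := by
  intro hS
  have hu₀ : Tendsto (fun n : ℕ => 1 / ((n : ℝ) + 1)) atTop (𝓝[>] (0 : ℝ)) :=
    tendsto_one_div_strictMono_add_one_nhdsWithin_Ioi strictMono_id
  exact ⟨fun n : ℕ => 1 / ((n : ℝ) + 1), hu₀, Literature.Probability.RandomPlanarGeometry.cardyFunction,
    fun R ψ x hx => (hS R ψ x hx).comp hu₀⟩

/-! ### The child and X_M in the cluster-set language of the route -/

/-- **The child in cluster-set language: `Λ' ∩ CI ≠ ∅`.** SOME cluster point `g`, as `δ → 0⁺`, of the
crossing-function path `δ ↦ (R ↦ bondDomainCrossingProb R δ)` factors through the conformal modulus.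
(Cluster points are exactly joint sequential limits, `clusterPt_iff_jointLimit`; a modulus kernel `G`
defines the rectangle-indexed limit `R ↦ G (crossRatio x_R)` at a chosen uniformizing datum, limits
being unique.) [folklore] -/
theorem conformalSublimit_iff_exists_conformal_clusterPt : (∃ u : ℕ → ℝ, Filter.Tendsto u Filter.atTop (nhdsWithin (0 : ℝ) (Set.Ioi 0)) ∧ ∃ G : ℝ → ℝ, ∀ (R : Literature.Probability.RandomPlanarGeometry.ConformalRectangle) (ψ : Literature.Probability.RandomPlanarGeometry.ConformalEquiv UpperHalfPlane.upperHalfPlaneSet R.carrier) (x : Fin 4 → ℝ), R.IsUniformizing ψ x → Filter.Tendsto (fun n => Literature.Probability.Percolation.bondDomainCrossingProb R (u n)) Filter.atTop (nhds (G (Literature.Probability.RandomPlanarGeometry.crossRatio x)))) ↔ ∃ g : Literature.Probability.RandomPlanarGeometry.ConformalRectangle → ℝ, (∃ G : ℝ → ℝ, ∀ (R : Literature.Probability.RandomPlanarGeometry.ConformalRectangle) (ψ : Literature.Probability.RandomPlanarGeometry.ConformalEquiv UpperHalfPlane.upperHalfPlaneSet R.carrier) (x : Fin 4 → ℝ), R.IsUniformizing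 ψ x → g R = G (Literature.Probability.RandomPlanarGeometry.crossRatio x)) ∧ MapClusterPt g (nhdsWithin (0 : ℝ) (Set.Ioi 0)) (fun (δ : ℝ) (R : Literature.Probability.RandomPlanarGeometry.ConformalRectangle) => Literature.Probability.Percolation.bondDomainCrossingProb R δ) := by
  classical
  constructor
  · rintro ⟨u, hu, G, hG⟩
    -- the rectangle-indexed joint limit: `G` at the modulus of a chosen uniformizing datum
    let gR : ConformalRectangle → ℝ := fun R ↦
      G (crossRatio (Classical.choose (Classical.choose_spec (MarkedDomain.exists_isUniformizing_holds R))))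
    have hgR : ∀ R : ConformalRectangle,
        Tendsto (fun n => bondDomainCrossingProb R (u n)) atTop (𝓝 (gR R)) := fun R ↦
      hG R _ _ (Classical.choose_spec (Classical.choose_spec (MarkedDomain.exists_isUniformizing_holds R)))
    refine ⟨gR, ⟨G, fun R φ x hx ↦ tendsto_nhds_unique (hgR R) (hG R φ x hx)⟩, ?_⟩
    exact (clusterPt_iff_jointLimit gR).2 ⟨u, hu, hgR⟩
  · rintro ⟨g, ⟨G, hG⟩, hg⟩
    obtain ⟨u, hu, hlim⟩ := (clusterPt_iff_jointLimit g).1 hg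
    exact ⟨u, hu, G, fun R φ x hx ↦ hG R φ x hx ▸ hlim R⟩

/-- **X_M in cluster-set language: `Λ' ⊆ CI`.** `CardyMirrorMonotone.SubseqConformalInvariance`
(stmt-8266) holds iff EVERY cluster point of the crossing-function path factors through the conformal
modulus (`subseqConformalInvariance_iff_stub_limitConformal` + `clusterPt_iff_jointLimit`). Contrast
with `conformalSublimit_iff_exists_conformal_clusterPt`: the child of the split asks it of ONE
cluster point. [folklore] -/
theorem subseqConformalInvariance_iff_forall_clusterPt_conformal : Summit.CriticalPhenomena.CardyFormulaZ2.Theses.CardyMirrorMonotone.SubseqConformalInvariance ↔ ∀ g : Literature.Probability.RandomPlanarGeometry.ConformalRectangle → ℝ, MapClusterPt g (nhdsWithin (0 : ℝ) (Set.Ioi 0)) (fun (δ : ℝ) (R : Literature.Probability.RandomPlanarGeometry.ConformalRectangle) => Literature.Probability.Percolation.bondDomainCrossingProb R δ) → ∃ G : ℝ → ℝ, ∀ (R : Literature.Probability.RandomPlanarGeometry.ConformalRectangle) (ψ : Literature.Probability.RandomPlanarGeometry.ConformalEquiv UpperHalfPlane.upperHalfPlaneSet R.carrier) (x : Fin 4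 → ℝ), R.IsUniformizing ψ x → g R = G (Literature.Probability.RandomPlanarGeometry.crossRatio x) := by
  rw [subseqConformalInvariance_iff_stub_limitConformal]
  constructor
  · intro h g hg
    obtain ⟨u, hu, hlim⟩ := (clusterPt_iff_jointLimit g).1 hg
    exact h u hu g hlim
  · intro h u hu g hg
    exact h g ((clusterPt_iff_jointLimit g).2 ⟨u, hu, hg⟩)

/-- **X_M implies the child, in cluster-set language** (`Λ' ⊆ CI` and `Λ' ≠ ∅` give `Λ' ∩ CI ≠ ∅`;
`Λ'` is non-empty by the proved precompactness `jointSubseqLimit`). [folklore] -/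
theorem exists_conformal_clusterPt_of_forall : (∀ g : Literature.Probability.RandomPlanarGeometry.ConformalRectangle → ℝ, MapClusterPt g (nhdsWithin (0 : ℝ) (Set.Ioi 0)) (fun (δ : ℝ) (R : Literature.Probability.RandomPlanarGeometry.ConformalRectangle) => Literature.Probability.Percolation.bondDomainCrossingProb R δ) → ∃ G : ℝ → ℝ, ∀ (R : Literature.Probability.RandomPlanarGeometry.ConformalRectangle) (ψ : Literature.Probability.RandomPlanarGeometry.ConformalEquiv UpperHalfPlane.upperHalfPlaneSet R.carrier) (x : Fin 4 → ℝ), R.IsUniformizing ψ x → g R = G (Literature.Probability.RandomPlanarGeometry.crossRatio x)) → ∃ g : Literature.Probability.RandomPlanarGeometry.ConformalRectangle → ℝ, (∃ G : ℝ → ℝ, ∀ (R : Literature.Probability.RandomPlanarGeometry.ConformalRectangle) (ψ : Literature.Probability.RandomPlanarGeometry.ConformalEquiv UpperHalfPlane.upperHalfPlaneSet R.carrier) (x : Fin 4 → ℝ), R.IsUniformizing ψ x → g R = G (Literature.Probability.RandomPlanarGeometry.crossRatio x)) ∧ MapClusterPt g (nhdsWithin (0 : ℝ) (Set.Ioi 0))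 (fun (δ : ℝ) (R : Literature.Probability.RandomPlanarGeometry.ConformalRectangle) => Literature.Probability.Percolation.bondDomainCrossingProb R δ) := by
  intro h
  obtain ⟨u, hu, g, hg⟩ := jointSubseqLimit
  have hcl := (clusterPt_iff_jointLimit g).2 ⟨u, hu, hg⟩
  exact ⟨g, h g hcl, hcl⟩

end Summit.CriticalPhenomena.CardyFormulaZ2.Cruxes.SubseqCardy.Split
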